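import Summits.SmoothPoincare4.SmoothPoincare4.Theorems.ConvexBisectionAcyclicBisectionExistsBeltPushoffAssembly
import Summits.SmoothPoincare4.SmoothPoincare4.Theorems.ConvexBisectionAcyclicBisectionExistsDualLinkTransport
import Summits.SmoothPoincare4.SmoothPoincare4.Theorems.ConvexBisectionAcyclicBisectionExistsSeamShadowTransport
import Summits.SmoothPoincare4.SmoothPoincare4.Theorems.ConvexBisectionAcyclicBisectionExistsPageInvariance
import Summits.SmoothPoincare4.SmoothPoincare4.Theorems.ConvexBisectionAcyclicBisectionExistsDualHandlePlumbing
import HarnessLib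

/-!
# Dual handles, node Hgap ("T3c-3 WITH DATA"), part A-3: the homology shadow of a dual attaching circle
(sub-goal of stub `stub_T3_dualPresentation` (T3), line `modp-braid-orbits`, crux
`ConvexBisection.AcyclicBisectionExists`, item stmt-SmoothPoincare4-10508; wave 6, lead c5, worker G1;
registered sub-goal `helper_shadow_dualMap`)

Let `(X, h, D, bX, Ψ)` be a fibred model of a Lefschetz link `l` over the cap `Base g` (page clause on
the seam).  The `k`-th DUAL attaching circle on the cap is `Ψ` of the `k`-th belt circle
(`attachingCircle_dualMap`, `attachingCircle_pushedMap`).  Its homology shadow in `H₁(Base g) = ℤ^{2g}`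
is computed by reusing the landed T3c chain for exactly what it delivers:

* (T3c-1′, Y1 `helper_belt_isotopic_pushoff`) IN `∂X` the belt circle is isotopic to a page push-off
  `jA ∘ K_k` of the `k`-th attaching circle, `K_k ⊂ page g (pageDir |l| k · e^{-iη})` off the cores, of
  shadow `±(l.get k).1`;
* (Z7 `helper_linkIsotopy_seamTransport`) the push of this isotopy through the seam diffeomorphism
  `seamDiffeo bX (bBase g) Ψ` is an isotopy of knots in `∂ Base g` from the dual attaching circle to
  `incl ∘ Ψ ∘ z`, `bX.incl ∘ z = jA ∘ K_k`;
* (shadow is an isotopy invariant in `Base g`, `shadow_eq_of_smoothIsotopy`);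
* (T3c-2 ST3, Y3 `helper_seam_shadowTransport`) `shadow (incl ∘ Ψ ∘ z) = A (shadow K_k)` for a linear
  AUTOMORPHISM `A` of `ℤ^{2g}` depending on the direction only.

Hence `shadow (dual circle k) = ±A ((l.get k).1)` (`exists_shadow_dualMap`), non-zero as soon as
`(l.get k).1 ≠ 0` (`shadow_dualMap_ne_zero`).  NOTE for the node Hgap: without the hypothesis
`(l.get k).1 ≠ 0` the dual shadow VANISHES (`A 0 = 0`), so the shadow clause of Hgap needs
`∀ x ∈ N, x.1 ≠ 0` (available in T3: `∀ x ∈ P ++ N, x.1 ≠ 0`).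

Everything is proved; no named facts, no `sorry`, no `def`.

## References
* R. İ. Baykur, *Kähler decomposition of 4-manifolds*, AGT 6 (2006), proof of Thm. 5.1, p. 13. [Baykur2006]
* A. Hatcher, *Algebraic Topology* (2002), Thm. 2A.1. [HatcherAT2002]
-/

noncomputable section

-- the prescribed namespace `Summit.<P>.<Sub>.…` duplicates `SmoothPoincare4` (P = Sub)
set_option linter.dupNamespace false

open scoped Manifold ContDiff Topology

namespace Summit.SmoothPoincare4.SmoothPoincare4.Theorems.AcyclicBisectionExists.ModpBraidOrbits

open Set Function Metric
open Literature.Topology.FourManifolds Literature.Topology.FourManifolds.HandleAttachingMap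
  Literature.Topology.FourManifolds.LefschetzBase Literature.Geometry.Symplectic

namespace HgapShadow

variable {g : ℕ} {l : List ((Fin g ⊕ Fin g → ℤ) × Bool)} {h : Fin l.length → HandleAttachingMap 3 2 (Base g)}
  {X : Type} [TopologicalSpace X] [T2Space X] [SecondCountableTopology X] [CompactSpace X]
  [ChartedSpace (EuclideanHalfSpace 4) X] [IsManifold (𝓡∂ 4) ∞ X]

/-- Equal loops have equal shadows (the continuity proof is irrelevant). [folklore] -/
theorem shadow_congr {K K' : sphere (0 : EuclideanSpace ℝ (Fin 2)) 1 → Base g} (hK : Continuous K)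
    (hK' : Continuous K') (e : K = K') : shadow g K hK = shadow g K' hK' := by
  subst e; rfl

/-- A small positive angle `η` with `η · |l| < π`. [folklore] -/
theorem exists_small_angle (n : ℕ) : ∃ η : ℝ, 0 < η ∧ η * n < Real.pi := by
  refine ⟨Real.pi / (2 * (n + 1)), by positivity, ?_⟩
  rw [div_mul_eq_mul_div, div_lt_iff₀ (by positivity)]
  nlinarith [Real.pi_pos, (Nat.cast_nonneg n : (0 : ℝ) ≤ _)]

/-- The rotated page direction `pageDir |l| k · e^{-iη}` is a unit complex number. [folklore] -/
theorem norm_pageDir_mul_exp (n k : ℕ) (η : ℝ) :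
    ‖pageDir n k * Complex.exp (-(η : ℂ) * Complex.I)‖ = 1 := by
  have he1 : ‖Complex.exp (-(η : ℂ) * Complex.I)‖ = 1 := by
    rw [show (-(η : ℂ) * Complex.I) = ((-η : ℝ) : ℂ) * Complex.I by push_cast; ring,
      Complex.norm_exp_ofReal_mul_I]
  rw [norm_mul, norm_pageDir, he1, mul_one]

/-- **The shadow of the `k`-th dual attaching circle is `±A ((l.get k).1)` for a linear automorphism `A`
of `ℤ^{2g}`** (the T3c chain: belt circle ∼ page push-off in `∂X` (Y1), pushed through the seam (Z7),
shadow invariance under isotopy, Y3's seam shadow transport ST3). [cite: Baykur2006, Thm. 5.1 (proof, p. 13)] -/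
theorem exists_shadow_dualMap (hlink : IsLefschetzLink g l h) (D : MultiAttachmentData h (𝓡∂ 4) X)
    (bX : BoundaryData (𝓡∂ 4) X (𝓡 3)) (Ψ : bX.carrier ≃ₘ⟮𝓡 3, 𝓡 3⟯ (bBase g).carrier)
    (hpage : ∀ (y : bX.carrier) (a : ↥(coresComplement h)), bX.incl y = D.jA a →
      ∃ c : ℝ, 0 < c ∧ w g ((bBase g).incl (Ψ y)).1 = (c : ℂ) * w g (a : Base g).1)
    (col : (BoundaryManifold.boundaryData 3 (Base g)).Collar) (κ δ : ℝ) (hκ : 0 < κ) (hκ1 : κ ≤ 1)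
    (hδ : 0 < δ) (hδ2 : δ ≤ 1 / 2) (k : Fin l.length) :
    ∃ A : (Fin g ⊕ Fin g → ℤ) ≃ₗ[ℤ] (Fin g ⊕ Fin g → ℤ),
      shadow g (dualMap D bX (bBase g) Ψ col κ δ hκ hκ1 hδ hδ2 k).attachingCircle
          (dualMap D bX (bBase g) Ψ col κ δ hκ hκ1 hδ hδ2 k).continuous_attachingCircle = A (l.get k).1 ∨
      shadow g (dualMap D bX (bBase g) Ψ col κ δ hκ hκ1 hδ hδ2 k).attachingCircle
          (dualMap D bX (bBase g) Ψ col κ δ hκ hκ1 hδ hδ2 k).continuous_attachingCircle = -(A (l.get k).1) := by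
  -- a small angle and the page push-offs of T3c-1′ (Y1)
  obtain ⟨η, hη, hηπ⟩ := exists_small_angle l.length
  obtain ⟨σ₀, K, ν, hKc, hK, Φ₁, νt₁, -, hKpage, -, -, hKsh, -, hfr₁, -⟩ :=
    helper_belt_isotopic_pushoff g l h hlink D η hη hηπ
  -- push the isotopy through the seam (Z7)
  obtain ⟨hL, hL', Φ₁', νt₁', -, -⟩ := helper_linkIsotopy_seamTransport (seamDiffeo bX (bBase g) Ψ)
    (fun j => (beltMap D j).attachingCircle) (fun j θ => D.jA ⟨K j θ, hK j θ⟩) Φ₁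
    (fun j => (beltMap D j).attachingFraming) νt₁ hfr₁
  -- the direction of the push-off page and Y3's shadow transport (ST3)
  obtain ⟨A, hA⟩ := helper_seam_shadowTransport g l h X D bX Ψ hlink hpage
    (pageDir l.length k * Complex.exp (-(η : ℂ) * Complex.I)) (norm_pageDir_mul_exp _ _ _)
  -- the lifts of the end knot to `bX.carrier`
  let R := (BoundaryManifold.boundaryData 3 X).restrictDiffeomorph bX (Diffeomorph.refl (𝓡∂ 4) X ∞)
  let z : sphere (0 : EuclideanSpace ℝ (Fin 2)) 1 → bX.carrier := fun θ => R ⟨D.jA ⟨K k θ, hK k θ⟩, hL' k θ⟩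
  have hzi : ∀ θ, bX.incl (z θ) = D.jA ⟨K k θ, hK k θ⟩ := fun θ => incl_restrict_refl bX _
  -- the end knot of the pushed isotopy is `incl ∘ Ψ ∘ z`
  have hKz : (fun θ => (BoundaryManifold.boundaryData 3 (Base g)).incl
      (seamDiffeo bX (bBase g) Ψ ⟨D.jA ⟨K k θ, hK k θ⟩, hL' k θ⟩)) =
      fun θ => ((bBase g).incl (Ψ (z θ)) : Base g) :=
    funext fun θ => coe_seamDiffeo bX (bBase g) Ψ _
  have hend : Continuous fun θ => (BoundaryManifold.boundaryData 3 (Base g)).incl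
      (seamDiffeo bX (bBase g) Ψ ⟨D.jA ⟨K k θ, hK k θ⟩, hL' k θ⟩) :=
    (Φ₁'.isotopy k).isBoundaryKnot_right.isSmoothEmbedding.isEmbedding.continuous
  have hGz : Continuous fun θ => ((bBase g).incl (Ψ (z θ)) : Base g) := by
    rw [← hKz]; exact hend
  -- the start knot of the pushed isotopy is the dual attaching circle
  have hstart : Continuous fun u => (BoundaryManifold.boundaryData 3 (Base g)).incl
      (seamDiffeo bX (bBase g) Ψ ⟨(beltMap D k).attachingCircle u, hL k u⟩) :=
    (Φ₁'.isotopy k).isBoundaryKnot_left.isSmoothEmbedding.isEmbedding.continuous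
  have hq0 : (dualMap D bX (bBase g) Ψ col κ δ hκ hκ1 hδ hδ2 k).attachingCircle =
      fun u => (BoundaryManifold.boundaryData 3 (Base g)).incl
        (seamDiffeo bX (bBase g) Ψ ⟨(beltMap D k).attachingCircle u, hL k u⟩) :=
    funext fun u => attachingCircle_pushedMap (beltMap D k) (seamDiffeo bX (bBase g) Ψ) col κ δ hκ hκ1 hδ hδ2 u
  -- the chain of equalities of shadows
  have h1 := shadow_congr (dualMap D bX (bBase g) Ψ col κ δ hκ hκ1 hδ hδ2 k).continuous_attachingCircle
    hstart hq0
  have h2 : shadow g _ hstart = shadow g _ hend :=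
    shadow_eq_of_smoothIsotopy (Φ₁'.isotopy k).toSmoothIsotopy hstart hend
  have h3 := shadow_congr hend hGz hKz
  have h4 := hA (K k) (hKc k) (hK k) (hKpage k) z hzi hGz
  refine ⟨A, ?_⟩
  rw [h1, h2, h3, h4]
  rcases hKsh k with h5 | h5
  · exact Or.inl (by rw [h5])
  · exact Or.inr (by rw [h5, map_neg])

/-- **The shadow of the `k`-th dual attaching circle is non-zero if the `k`-th class of the word is**
(automorphisms are injective). [cite: Baykur2006, Thm. 5.1 (proof, p. 13)] -/
theorem shadow_dualMap_ne_zero (hlink : IsLefschetzLink g l h) (D : MultiAttachmentData h (𝓡∂ 4) X)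
    (bX : BoundaryData (𝓡∂ 4) X (𝓡 3)) (Ψ : bX.carrier ≃ₘ⟮𝓡 3, 𝓡 3⟯ (bBase g).carrier)
    (hpage : ∀ (y : bX.carrier) (a : ↥(coresComplement h)), bX.incl y = D.jA a →
      ∃ c : ℝ, 0 < c ∧ w g ((bBase g).incl (Ψ y)).1 = (c : ℂ) * w g (a : Base g).1)
    (col : (BoundaryManifold.boundaryData 3 (Base g)).Collar) (κ δ : ℝ) (hκ : 0 < κ) (hκ1 : κ ≤ 1)
    (hδ : 0 < δ) (hδ2 : δ ≤ 1 / 2) (k : Fin l.length) (hk : (l.get k).1 ≠ 0) :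
    shadow g (dualMap D bX (bBase g) Ψ col κ δ hκ hκ1 hδ hδ2 k).attachingCircle
      (dualMap D bX (bBase g) Ψ col κ δ hκ hκ1 hδ hδ2 k).continuous_attachingCircle ≠ 0 := by
  obtain ⟨A, hA⟩ := exists_shadow_dualMap hlink D bX Ψ hpage col κ δ hκ hκ1 hδ hδ2 k
  have hA0 : A (l.get k).1 ≠ 0 := fun h0 => hk (A.map_eq_zero_iff.1 h0)
  rcases hA with h1 | h1 <;> rw [h1]
  · exact hA0
  · exact neg_ne_zero.2 hA0

/-- **Shadows of the transported dual circles**: transporting along a stage of an ambient isotopy of the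
cap does not change the shadow (`shadow_comp_ambientIsotopy`), so the straightened dual attaching circles
have non-zero shadows too. [cite: Baykur2006, Thm. 5.1 (proof, p. 13)] -/
theorem shadow_transport_dualMap_ne_zero (hlink : IsLefschetzLink g l h) (D : MultiAttachmentData h (𝓡∂ 4) X)
    (bX : BoundaryData (𝓡∂ 4) X (𝓡 3)) (Ψ : bX.carrier ≃ₘ⟮𝓡 3, 𝓡 3⟯ (bBase g).carrier)
    (hpage : ∀ (y : bX.carrier) (a : ↥(coresComplement h)), bX.incl y = D.jA a →
      ∃ c : ℝ, 0 < c ∧ w g ((bBase g).incl (Ψ y)).1 = (c : ℂ) * w g (a : Base g).1)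
    (col : (BoundaryManifold.boundaryData 3 (Base g)).Collar) (κ δ : ℝ) (hκ : 0 < κ) (hκ1 : κ ≤ 1)
    (hδ : 0 < δ) (hδ2 : δ ≤ 1 / 2) (k : Fin l.length) (hk : (l.get k).1 ≠ 0)
    (R : AmbientIsotopy (𝓡∂ 4) (Base g)) (s : ℝ) :
    shadow g ((dualMap D bX (bBase g) Ψ col κ δ hκ hκ1 hδ hδ2 k).transport (R.toDiffeomorph s)).attachingCircle
      ((dualMap D bX (bBase g) Ψ col κ δ hκ hκ1 hδ hδ2 k).transport (R.toDiffeomorph s)).continuous_attachingCircle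
        ≠ 0 := by
  have key : ∀ (K : sphere (0 : EuclideanSpace ℝ (Fin 2)) 1 → Base g) (hK : Continuous K),
      K = R.toFun s ∘ (dualMap D bX (bBase g) Ψ col κ δ hκ hκ1 hδ hδ2 k).attachingCircle →
        shadow g K hK = shadow g (dualMap D bX (bBase g) Ψ col κ δ hκ hκ1 hδ hδ2 k).attachingCircle
          (dualMap D bX (bBase g) Ψ col κ δ hκ hκ1 hδ hδ2 k).continuous_attachingCircle := by
    rintro K hK rfl
    exact shadow_comp_ambientIsotopy R s (dualMap D bX (bBase g) Ψ col κ δ hκ hκ1 hδ hδ2 k).continuous_attachingCircle hK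
  have e := key ((dualMap D bX (bBase g) Ψ col κ δ hκ hκ1 hδ hδ2 k).transport (R.toDiffeomorph s)).attachingCircle
    ((dualMap D bX (bBase g) Ψ col κ δ hκ hκ1 hδ hδ2 k).transport (R.toDiffeomorph s)).continuous_attachingCircle rfl
  rw [e]
  exact shadow_dualMap_ne_zero hlink D bX Ψ hpage col κ δ hκ hκ1 hδ hδ2 k hk

/-! ## Suffix bookkeeping: `l = P ++ N`, `k = |P| + j` -/

/-- `(P ++ N).get (sfx j) = N.get j` for the suffix position `sfx j = Fin.cast _ (Fin.natAdd |P| j)`.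
[folklore] -/
theorem get_append_sfx (P N : List ((Fin g ⊕ Fin g → ℤ) × Bool)) (j : Fin N.length) :
    (P ++ N).get (Fin.cast List.length_append.symm (Fin.natAdd P.length j)) = N.get j := by
  simp [List.getElem_append_right]

/-- **Shadows of the straightened dual circles of the SUFFIX handles are non-zero** when the classes of
`N` are (the form consumed by the Hgap assembly). [cite: Baykur2006, Thm. 5.1 (proof, p. 13)] -/
theorem shadow_transport_dualMap_sfx_ne_zero {P N : List ((Fin g ⊕ Fin g → ℤ) × Bool)}
    {h : Fin (P ++ N).length → HandleAttachingMap 3 2 (Base g)} (hlink : IsLefschetzLink g (P ++ N) h)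
    (D : MultiAttachmentData h (𝓡∂ 4) X)
    (bX : BoundaryData (𝓡∂ 4) X (𝓡 3)) (Ψ : bX.carrier ≃ₘ⟮𝓡 3, 𝓡 3⟯ (bBase g).carrier)
    (hpage : ∀ (y : bX.carrier) (a : ↥(coresComplement h)), bX.incl y = D.jA a →
      ∃ c : ℝ, 0 < c ∧ w g ((bBase g).incl (Ψ y)).1 = (c : ℂ) * w g (a : Base g).1)
    (col : (BoundaryManifold.boundaryData 3 (Base g)).Collar) (κ δ : ℝ) (hκ : 0 < κ) (hκ1 : κ ≤ 1)
    (hδ : 0 < δ) (hδ2 : δ ≤ 1 / 2) (hN0 : ∀ x ∈ N, x.1 ≠ 0)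
    (R : AmbientIsotopy (𝓡∂ 4) (Base g)) (s : ℝ) (j : Fin N.length) :
    shadow g ((dualMap D bX (bBase g) Ψ col κ δ hκ hκ1 hδ hδ2
        (Fin.cast List.length_append.symm (Fin.natAdd P.length j))).transport (R.toDiffeomorph s)).attachingCircle
      ((dualMap D bX (bBase g) Ψ col κ δ hκ hκ1 hδ hδ2
        (Fin.cast List.length_append.symm (Fin.natAdd P.length j))).transport
          (R.toDiffeomorph s)).continuous_attachingCircle ≠ 0 := by
  refine shadow_transport_dualMap_ne_zero hlink D bX Ψ hpage col κ δ hκ hκ1 hδ hδ2 _ ?_ R s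
  rw [get_append_sfx P N j]
  exact hN0 _ (List.get_mem N j)

end HgapShadow

open HgapShadow

/-! ## Registered helper -/

/-- **Sub-goal `helper_shadow_dualMap` of stub `stub_T3_dualPresentation`** (node Hgap, part A-3; wave 6,
lead c5): in a fibred model `(X, h, D, bX, Ψ)` of a Lefschetz link `l` over `Base g`, the homology shadow of
the `k`-th dual attaching circle on the cap is `±A ((l.get k).1)` for a linear automorphism `A` of
`ℤ^{2g}`; in particular it is non-zero if `(l.get k).1 ≠ 0`. [cite: Baykur2006, Thm. 5.1 (proof, p. 13)] -/
theorem helper_shadow_dualMap : ∀ (g : ℕ) (l : List ((Fin g ⊕ Fin g → ℤ) × Bool)) (h : Fin l.length → Literature.Topology.FourManifolds.HandleAttachingMap 3 2 (Literature.Topology.FourManifolds.LefschetzBase.Base g)) (_ : Literature.Topology.FourManifolds.LefschetzBase.IsLefschetzLink g l h) {X : Type} [TopologicalSpace X] [T2Space X] [SecondCountableTopology X] [CompactSpace X] [ChartedSpace (EuclideanHalfSpace 4) X] [IsManifold (𝓡∂ 4) ∞ X] (D : Literature.Topology.FourManifolds.HandleAttachingMap.MultiAttachmentData h (𝓡∂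 4) X) (bX : Literature.Topology.FourManifolds.BoundaryData (𝓡∂ 4) X (𝓡 3)) (Ψ : bX.carrier ≃ₘ⟮𝓡 3, 𝓡 3⟯ (Literature.Topology.FourManifolds.LefschetzBase.bBase g).carrier) (_ : ∀ (y : bX.carrier) (a : ↥(Literature.Topology.FourManifolds.HandleAttachingMap.coresComplement h)), bX.incl y = D.jA a → ∃ c : ℝ, 0 < c ∧ Literature.Topology.FourManifolds.LefschetzBase.w g ((Literature.Topology.FourManifolds.LefschetzBase.bBase g).incl (Ψ y)).1 = (c : ℂ) * Literature.Topology.FourManifolds.LefschetzBase.w g (a : Literature.Topology.FourManifolds.LefschetzBase.Base g).1) (col : (Literature.Topology.FourManifolds.BoundaryManifold.boundaryData 3 (Literature.Topology.FourManifolds.LefschetzBase.Base g)).Collar) (κ δ : ℝ) (hκ : 0 < κ) (hκ1 : κ ≤ 1) (hδ : 0 < δ) (hδ2 : δ ≤ 1 / 2) (k : Fin l.length), (∃ A : (Fin g ⊕ Fin g → ℤ) ≃ₗ[ℤ] (Fin g ⊕ Fin g → ℤ), Literature.Topology.FourManifolds.LefschetzBase.shadow g (Summit.SmoothPoincare4.SmoothPoincare4.Theorems.AcyclicBisectionExists.ModpBraidOrbits.dualMap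 D bX (Literature.Topology.FourManifolds.LefschetzBase.bBase g) Ψ col κ δ hκ hκ1 hδ hδ2 k).attachingCircle (Summit.SmoothPoincare4.SmoothPoincare4.Theorems.AcyclicBisectionExists.ModpBraidOrbits.dualMap D bX (Literature.Topology.FourManifolds.LefschetzBase.bBase g) Ψ col κ δ hκ hκ1 hδ hδ2 k).continuous_attachingCircle = A (l.get k).1 ∨ Literature.Topology.FourManifolds.LefschetzBase.shadow g (Summit.SmoothPoincare4.SmoothPoincare4.Theorems.AcyclicBisectionExists.ModpBraidOrbits.dualMap D bX (Literature.Topology.FourManifolds.LefschetzBase.bBase g) Ψ col κ δ hκ hκ1 hδ hδ2 k).attachingCircle (Summit.SmoothPoincare4.SmoothPoincare4.Theorems.AcyclicBisectionExists.ModpBraidOrbits.dualMap D bX (Literature.Topology.FourManifolds.LefschetzBase.bBase g) Ψ col κ δ hκ hκ1 hδ hδ2 k).continuous_attachingCircle = -(A (l.get k).1)) ∧ ((l.get k).1 ≠ 0 → Literature.Topology.FourManifolds.LefschetzBase.shadow g (Summit.SmoothPoincare4.SmoothPoincare4.Theorems.AcyclicBisectionExists.ModpBraidOrbits.dualMap D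 bX (Literature.Topology.FourManifolds.LefschetzBase.bBase g) Ψ col κ δ hκ hκ1 hδ hδ2 k).attachingCircle (Summit.SmoothPoincare4.SmoothPoincare4.Theorems.AcyclicBisectionExists.ModpBraidOrbits.dualMap D bX (Literature.Topology.FourManifolds.LefschetzBase.bBase g) Ψ col κ δ hκ hκ1 hδ hδ2 k).continuous_attachingCircle ≠ 0) := by
  intro g l h hlink X _ _ _ _ _ _ D bX Ψ hpage col κ δ hκ hκ1 hδ hδ2 k
  exact ⟨exists_shadow_dualMap hlink D bX Ψ hpage col κ δ hκ hκ1 hδ hδ2 k,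
    shadow_dualMap_ne_zero hlink D bX Ψ hpage col κ δ hκ hκ1 hδ hδ2 k⟩

end Summit.SmoothPoincare4.SmoothPoincare4.Theorems.AcyclicBisectionExists.ModpBraidOrbits

end
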